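import Summits.Ventures.CertifiedManyBodySolver.Observables.SourcedTorusTTPrimeT0AHMSandwich
import Literature.MathematicalPhysics.QuantumLattice.TIGroundStatePairLROCeiling
import Literature.MathematicalPhysics.QuantumLattice.DWaveOrderParameterRightDerivativeTTPrime
import Literature.MathematicalPhysics.QuantumLattice.DWaveSourceNNNHoppingEnergyDensityExists

/-!
# The pair-LRO CEILING of translation-invariant sourced ground states — ASSEMBLY of steps (ζ)+(η),
# modulo the box→torus bound (ε)

Cell `hubbard-cq` (venture `CertifiedManyBodySolver`; transplant-1 DICTIONARY §12 proof chain for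
`Literature.MathematicalPhysics.QuantumLattice.TIGroundStatePairLROCeiling` — the infinite-volume
translation-invariant form of Koma–Tasaki's Theorem 7.3, whose corollaries `sharpKomaTasaki_of_ceiling`
(max over TI ground states of the asymptotic box pair LRO `= (m⋆)²`) and `clustering_of_ceiling` are in the
tree CONDITIONALLY). Steps (α) hubbard-cq-p1, (β) hubbard-cq-p3, (γ) hubbard-cq-p4, (δ) hubbard-cq-p1 are
joined in `SourcedTorusTTPrimeT0AHMSandwich.lean` (`ahmTT'_sandwich`); this file performs (ζ) (`L → ∞` at
fixed coupling `g`) and (η) (`g → 0⁺` by right-continuity of `∂⁺E`), taking step (ε) — the box→torus state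
bound, owned by hubbard-cq-p4 — as ONE explicit hypothesis. Notation: `A_L(h) = dWaveSourceTorusTT' L t' U μ h`,
`E_L(h) = E₀(A_L(h))`, `E = dWaveSourceEnergyDensityTT' t' U μ` (`E_L/L² → E`), `m_L = dWaveSourceDensityTT'`,
`‖P‖ = K_d = 2Σ_e|d(e)/√2|`, `boxLRO_L(ω) = Re L⁻⁴ Σ_{x,y∈[0,L)²} ω(P_x^d⋆P_y^d)`.

* `rightDeriv_dWaveSourceEnergyDensityTT'_nonpos` — `∂⁺E(x) ≤ 0` for `x ≥ 0`;
* `eventually_sq_dWaveSourceDensityTT'_le` — eventually in `L`, `m_L(x)² ≤ (∂⁺E(x)/2)² + δ` (`x ≥ 0`);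
* `exists_sq_half_rightDeriv_le_add` — (η): `(∂⁺E(x)/2)² ≤ (∂⁺E(h₀)/2)² + ε` on some `[h₀, h₀ + u)`;
* `boxLRO_le_of_bounds` — the real arithmetic of (ζ);
* **`tiGroundStatePairLROCeiling_of_boxTorusBound`** — IF (ε): for every `h₀ ≥ 0` and every
  translation-invariant ground state `ω` of `Ψ_{h₀}` there are `c₁ c₂ L₁` with
  `E₀(A_L(h₀) − (g/L²)Δ_dᴴΔ_d) ≤ L²·E(h₀) + c₁·L − g·L²·boxLRO_L(ω) + g·c₂·L` for all `L ≥ L₁`, `g ≥ 0`,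
  THEN `TIGroundStatePairLROCeiling t' U μ`.

So the ceiling — hence the SHARP infinite-volume Koma–Tasaki identity and finite-`h` `k = 0` clustering of
every translation-invariant sourced ground state — is reduced to the single box→torus inequality (ε).
HONEST SCOPE / WHAT THIS IS NOT: conditional on (ε); a T5-class dictionary statement about infinite-volume
translation-invariant ground states; no bearing on torus ground states (census (24)/(44)); no CQ bit; nothing
here floors `d`-wave order; not a superconductivity verdict. Everything PROVED; no definition, no named fact.

References: T. Koma, H. Tasaki, Commun. Math. Phys. 158 (1993) 191, Thm 7.3; N. N. Bogolyubov Jr. et al.,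
Russ. Math. Surveys 39:6 (1984); J.-B. Bru, W. de Siqueira Pedra, Mem. AMS 224 (2013), Appendix, Thm 107;
R. B. Griffiths, Phys. Rev. 152 (1966) 240, §II.
-/

noncomputable section

namespace Summit.Ventures.CertifiedManyBodySolver.Observables.SourcedTorusAHM

open Matrix Finset Filter Topology Set Literature.MathematicalPhysics.QuantumLattice
open Literature.Probability.LatticeModels
open scoped ComplexOrder

/-! ### Real-analysis helpers -/

/-- The right derivative of the sourced energy density is `≤ 0` at every `x ≥ 0` (`E` is antitone on
`[0, ∞)`). Twin of the tree's `leftDeriv_dWaveSourceEnergyDensityTT'_nonpos`. -/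
theorem rightDeriv_dWaveSourceEnergyDensityTT'_nonpos (tp U μ : ℝ) {x : ℝ} (hx : 0 ≤ x) :
    derivWithin (dWaveSourceEnergyDensityTT' tp U μ) (Ioi x) x ≤ 0 := by
  have hd := (hasDerivWithinAt_Ioi_Iio_dWaveSourceEnergyDensityTT' tp U μ x).1
  have ht : Tendsto (slope (dWaveSourceEnergyDensityTT' tp U μ) x) (𝓝[>] x)
      (𝓝 (derivWithin (dWaveSourceEnergyDensityTT' tp U μ) (Ioi x) x)) := by
    have := hasDerivWithinAt_iff_tendsto_slope.1 hd
    rwa [show Ioi x \ {x} = Ioi x from by simp] at this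
  refine le_of_tendsto ht ?_
  filter_upwards [Ioo_mem_nhdsGT (lt_add_one x)] with s hs
  rw [slope_def_field]
  have hnum : dWaveSourceEnergyDensityTT' tp U μ s - dWaveSourceEnergyDensityTT' tp U μ x ≤ 0 :=
    sub_nonpos.2 (dWaveSourceEnergyDensityTT'_anti tp U μ hx hs.1.le)
  have hden : 0 < s - x := sub_pos.2 hs.1
  exact div_nonpos_iff.2 (Or.inr ⟨hnum, hden.le⟩)

/-- Squares under a one-sided approximation: `0 ≤ a`, `0 ≤ m ≤ K`, `m < a + η`, `2Kη ≤ δ` ⇒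
`m² ≤ a² + δ`. -/
theorem sq_le_sq_add_of_lt_add {a m K η δ : ℝ} (ha : 0 ≤ a) (hm0 : 0 ≤ m) (hmK : m ≤ K)
    (hma : m < a + η) (hη : 0 ≤ η) (hKη : 2 * K * η ≤ δ) : m ^ 2 ≤ a ^ 2 + δ := by
  rcases le_or_gt m a with hle | hgt
  · nlinarith
  · have h1 : m ^ 2 - a ^ 2 = (m - a) * (m + a) := by ring
    have h2 : (m - a) * (m + a) ≤ η * (2 * K) :=
      mul_le_mul (by linarith) (by linarith) (by linarith) hη
    nlinarith

/-- **Eventually `m_L(x)² ≤ (∂⁺E(x)/2)² + δ`** along `L → ∞`, for `x ≥ 0` and `δ > 0`: from the tree's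
`limsup_L m_L(x) ≤ −∂⁺E(x)/2`, the a-priori bounds `0 ≤ m_L(x) ≤ ‖P‖` and `∂⁺E(x) ≤ 0`. -/
theorem eventually_sq_dWaveSourceDensityTT'_le (tp U μ : ℝ) {x : ℝ} (hx : 0 ≤ x) {δ : ℝ} (hδ : 0 < δ) :
    ∀ᶠ n : ℕ in atTop, dWaveSourceDensityTT' (n + 1) tp U μ x ^ 2 ≤
      (derivWithin (dWaveSourceEnergyDensityTT' tp U μ) (Ioi x) x / 2) ^ 2 + δ := by
  set K : ℝ := 2 * ∑ e ∈ insert (0 : Site 2) unitSteps, |dWaveFormFactor e / Real.sqrt 2| with hK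
  have hK0 : 0 ≤ K := by positivity
  set a : ℝ := -derivWithin (dWaveSourceEnergyDensityTT' tp U μ) (Ioi x) x / 2 with ha
  have ha0 : 0 ≤ a := by
    have := rightDeriv_dWaveSourceEnergyDensityTT'_nonpos tp U μ hx
    rw [ha]; linarith
  have hsq : (derivWithin (dWaveSourceEnergyDensityTT' tp U μ) (Ioi x) x / 2) ^ 2 = a ^ 2 := by
    rw [ha]; ring
  rw [hsq]
  set η : ℝ := δ / (2 * K + 1) with hη
  have hη0 : 0 < η := by positivity
  have hKη : 2 * K * η ≤ δ := by
    rw [hη, show 2 * K * (δ / (2 * K + 1)) = δ * (2 * K / (2 * K + 1)) by ring]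
    have h1 : 2 * K / (2 * K + 1) ≤ 1 := (div_le_one (by positivity)).2 (by linarith)
    calc δ * (2 * K / (2 * K + 1)) ≤ δ * 1 := mul_le_mul_of_nonneg_left h1 hδ.le
      _ = δ := mul_one _
  have hlim := limsup_dWaveSourceDensityTT'_le_neg_half_rightDeriv tp U μ
    (hasDerivWithinAt_Ioi_Iio_dWaveSourceEnergyDensityTT' tp U μ x).1
  have hbdd : IsBoundedUnder (· ≤ ·) atTop fun n : ℕ => dWaveSourceDensityTT' (n + 1) tp U μ x :=
    isBoundedUnder_of ⟨K, fun n => (le_abs_self _).trans (abs_dWaveSourceDensityTT'_le (n + 1) tp U μ x)⟩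
  have hev : ∀ᶠ n : ℕ in atTop, dWaveSourceDensityTT' (n + 1) tp U μ x < a + η :=
    eventually_lt_of_limsup_lt (lt_of_le_of_lt hlim (by rw [ha]; linarith)) hbdd
  filter_upwards [hev] with n hn
  exact sq_le_sq_add_of_lt_add ha0 (dWaveSourceDensityTT'_nonneg (L := n + 1) tp U μ hx)
    ((le_abs_self _).trans (abs_dWaveSourceDensityTT'_le (n + 1) tp U μ x)) hn hη0.le hKη

/-- **(η) Right-continuity of `(∂⁺E/2)²`**: for `ε > 0` there is `u > 0` with
`(∂⁺E(x)/2)² ≤ (∂⁺E(h₀)/2)² + ε` for all `x ∈ [h₀, h₀ + u)` (the tree's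
`tendsto_neg_half_rightDeriv_dWaveSourceEnergyDensityTT'_nhdsGT_of`, squared). -/
theorem exists_sq_half_rightDeriv_le_add (tp U μ h₀ : ℝ) {ε : ℝ} (hε : 0 < ε) :
    ∃ u : ℝ, 0 < u ∧ ∀ x : ℝ, h₀ ≤ x → x < h₀ + u →
      (derivWithin (dWaveSourceEnergyDensityTT' tp U μ) (Ioi x) x / 2) ^ 2 ≤
        (derivWithin (dWaveSourceEnergyDensityTT' tp U μ) (Ioi h₀) h₀ / 2) ^ 2 + ε := by
  set mp : ℝ → ℝ := fun x => -derivWithin (dWaveSourceEnergyDensityTT' tp U μ) (Ioi x) x / 2 with hmp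
  have hsq : ∀ x : ℝ, (derivWithin (dWaveSourceEnergyDensityTT' tp U μ) (Ioi x) x / 2) ^ 2 = mp x ^ 2 := by
    intro x; rw [hmp]; ring
  simp only [hsq]
  have hrc : Tendsto mp (𝓝[>] h₀) (𝓝 (mp h₀)) :=
    tendsto_neg_half_rightDeriv_dWaveSourceEnergyDensityTT'_nhdsGT_of tp U μ h₀
  have hrc2 : Tendsto (fun x => mp x ^ 2) (𝓝[>] h₀) (𝓝 (mp h₀ ^ 2)) := hrc.pow 2
  have hev : ∀ᶠ x in 𝓝[>] h₀, mp x ^ 2 < mp h₀ ^ 2 + ε :=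
    hrc2.eventually (Iio_mem_nhds (by linarith))
  obtain ⟨b, hb, hbI⟩ := (nhdsGT_basis h₀).eventually_iff.1 hev
  refine ⟨b - h₀, sub_pos.2 hb, fun x hx1 hx2 => ?_⟩
  rcases hx1.eq_or_lt with heq | hlt
  · rw [← heq]; linarith
  · exact (hbI ⟨hlt, by linarith⟩).le

/-- The arithmetic of step (ζ): the sandwich lower bound, the box→torus upper bound, the energy
convergence, the density bound and the right-continuity bound combine to `B ≤ a₀² + ε`. -/
theorem boxLRO_le_of_bounds {EL E Emod V ℓ g m a a₀ B c₁ c₂ ε : ℝ} (hV : 0 < V) (hg : 0 < g) (hε : 0 < ε)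
    (hlow : EL / V - g * m ^ 2 - g * ε / 8 ≤ Emod / V)
    (hup : Emod ≤ V * E + c₁ * ℓ - g * V * B + g * c₂ * ℓ)
    (hconv : E - EL / V ≤ g * ε / 8)
    (hm : m ^ 2 ≤ a ^ 2 + ε / 4) (ha : a ^ 2 ≤ a₀ ^ 2 + ε / 4)
    (hsmall : (c₁ + g * c₂) * ℓ / V ≤ g * ε / 8) :
    B ≤ a₀ ^ 2 + ε := by
  have hup' : Emod / V ≤ E + (c₁ + g * c₂) * ℓ / V - g * B := by
    rw [div_le_iff₀ hV]
    have e : (E + (c₁ + g * c₂) * ℓ / V - g * B) * V = V * E + c₁ * ℓ - g * V * B + g * c₂ * ℓ := by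
      field_simp
      ring
    rw [e]; exact hup
  have key : g * B ≤ g * (a₀ ^ 2 + 7 * ε / 8) := by nlinarith
  have := le_of_mul_le_mul_left key hg
  linarith


/-! ### The assembly: (ζ) + (η) modulo the box→torus bound (ε) -/

/-- **THE PAIR-LRO CEILING OF TRANSLATION-INVARIANT SOURCED GROUND STATES, modulo the box→torus bound
(ε).** IF for every `h₀ ≥ 0` and every translation-invariant ground state `ω` of `Ψ_{h₀}` the torus
restriction of `ω` bounds the crutch ground energy from above,
`E₀(A_L(h₀) − (g/L²)Δ_dᴴΔ_d) ≤ L²·E(h₀) + c₁L − g·L²·boxLRO_L(ω) + g·c₂L` for all `g ≥ 0` and `L ≥ L₁`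
(hubbard-cq-p4's step (ε): variational principle for the box→torus state, interior translates, `O(L³)`
wrapped pairs), THEN `TIGroundStatePairLROCeiling t' U μ`: for every `ε > 0`, eventually in `N`,
`boxLRO_N(ω) ≤ (∂⁺E(h₀)/2)² + ε`. Steps: (η) pick `u` with `(∂⁺E(x)/2)² ≤ (∂⁺E(h₀)/2)² + ε/4` on
`[h₀, h₀+u)` (`exists_sq_half_rightDeriv_le_add`) and `g > 0` with `2g‖P‖ < u`; (ζ) the finite-volume
sandwich `ahmTT'_sandwich` at accuracy `gε/8` and the hypothesis give
`g·boxLRO_L ≤ [E(h₀) − E_L(h₀)/L²] + g·m_L(h₀+2g‖P‖)² + gε/8 + (c₁ + gc₂)/L`; then `E_L/L² → E`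
(`tendsto_dWaveSourceEnergyDensityTT'`), `limsup m_L ≤ −∂⁺E/2` (`eventually_sq_dWaveSourceDensityTT'_le`)
and `1/L → 0`. Koma–Tasaki (1993) Thm 7.3 in the infinite-volume translation-invariant class, via
Bogoliubov Jr.'s approximating Hamiltonian (Bru–de Siqueira Pedra 2013, Thm 107). -/
theorem tiGroundStatePairLROCeiling_of_boxTorusBound (tp U μ : ℝ)
    (Hε : ∀ ⦃h₀ : ℝ⦄, 0 ≤ h₀ → ∀ ⦃ω : InfVolFermionState 2⦄,
      ω.IsMeanEnergyMinimiser (hubbardTTPrimeSourcedInteraction 1 tp U μ dWaveFormFactor h₀) 1 →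
      ∃ c₁ c₂ : ℝ, ∃ L₁ : ℕ, ∀ (L : ℕ) [NeZero L], L₁ ≤ L → ∀ g : ℝ, 0 ≤ g →
        (dWaveSourceTorusTT' L tp U μ h₀ - ((g / (L : ℝ) ^ 2 : ℝ) : ℂ) •
            ((pairField dWaveFormFactor L)ᴴ * pairField dWaveFormFactor L)).groundEnergy ≤
          (L : ℝ) ^ 2 * dWaveSourceEnergyDensityTT' tp U μ h₀ + c₁ * L -
            g * (L : ℝ) ^ 2 * (((L : ℂ) ^ 4)⁻¹ * ∑ x ∈ halfOpenBox 2 L, ∑ y ∈ halfOpenBox 2 L,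
              ω.dWavePairCorr x y).re + g * c₂ * L) :
    TIGroundStatePairLROCeiling tp U μ := by
  intro h₀ hh₀ ω hω ε hε
  have hK0 : (0 : ℝ) ≤ 2 * ∑ e ∈ insert (0 : Site 2) unitSteps, |dWaveFormFactor e / Real.sqrt 2| := by
    positivity
  -- (η): right-continuity of `(∂⁺E/2)²` at `h₀`, then a coupling `g > 0` with `2g‖P‖ < u`
  obtain ⟨u, hu0, hu⟩ := exists_sq_half_rightDeriv_le_add tp U μ h₀ (ε := ε / 4) (by positivity)
  obtain ⟨g, hgdef⟩ : ∃ g : ℝ,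
      g = u / (2 * (2 * (2 * ∑ e ∈ insert (0 : Site 2) unitSteps, |dWaveFormFactor e / Real.sqrt 2|) + 1)) :=
    ⟨_, rfl⟩
  have hg : 0 < g := by rw [hgdef]; positivity
  have h2gK : 2 * g * (2 * ∑ e ∈ insert (0 : Site 2) unitSteps, |dWaveFormFactor e / Real.sqrt 2|) < u := by
    set K : ℝ := 2 * ∑ e ∈ insert (0 : Site 2) unitSteps, |dWaveFormFactor e / Real.sqrt 2| with hK
    rw [hgdef]
    have e1 : 2 * (u / (2 * (2 * K + 1))) * K = u * (K / (2 * K + 1)) := by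
      field_simp
    rw [e1]
    have h1 : K / (2 * K + 1) < 1 := (div_lt_one (by positivity)).2 (by linarith)
    calc u * (K / (2 * K + 1)) < u * 1 := mul_lt_mul_of_pos_left h1 hu0
      _ = u := mul_one _
  have h2gK0 : 0 ≤ 2 * g * (2 * ∑ e ∈ insert (0 : Site 2) unitSteps, |dWaveFormFactor e / Real.sqrt 2|) := by
    positivity
  have hx0 : 0 ≤ h₀ + 2 * g * (2 * ∑ e ∈ insert (0 : Site 2) unitSteps, |dWaveFormFactor e / Real.sqrt 2|) := by
    linarith
  have ha := hu (h₀ + 2 * g * (2 * ∑ e ∈ insert (0 : Site 2) unitSteps, |dWaveFormFactor e / Real.sqrt 2|))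
    (by linarith) (by linarith)
  -- the finite-volume sandwich (α)(β)(γ)(δ) at accuracy `gε/8`, and the box→torus bound (ε)
  obtain ⟨L₀, hL₀⟩ := (ahmTT'_sandwich tp U g |μ| h₀ hg).2 (g * ε / 8) (by positivity)
  obtain ⟨c₁, c₂, L₁, hL₁⟩ := Hε hh₀ hω
  have hlow : ∀ᶠ n : ℕ in atTop,
      (dWaveSourceTorusTT' (n + 1) tp U μ h₀).groundEnergy / (((n + 1 : ℕ) : ℝ)) ^ 2 -
            g * dWaveSourceDensityTT' (n + 1) tp U μ (h₀ + 2 * g *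
              (2 * ∑ e ∈ insert (0 : Site 2) unitSteps, |dWaveFormFactor e / Real.sqrt 2|)) ^ 2 -
          g * ε / 8 ≤
        (dWaveSourceTorusTT' (n + 1) tp U μ h₀ - ((g / (((n + 1 : ℕ) : ℝ)) ^ 2 : ℝ) : ℂ) •
            ((pairField dWaveFormFactor (n + 1))ᴴ * pairField dWaveFormFactor (n + 1))).groundEnergy /
          (((n + 1 : ℕ) : ℝ)) ^ 2 :=
    eventually_atTop.2 ⟨L₀, fun n hn => hL₀ (n + 1) (by omega) μ le_rfl h₀ hh₀ le_rfl⟩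
  have hup : ∀ᶠ n : ℕ in atTop,
      (dWaveSourceTorusTT' (n + 1) tp U μ h₀ - ((g / (((n + 1 : ℕ) : ℝ)) ^ 2 : ℝ) : ℂ) •
          ((pairField dWaveFormFactor (n + 1))ᴴ * pairField dWaveFormFactor (n + 1))).groundEnergy ≤
        (((n + 1 : ℕ) : ℝ)) ^ 2 * dWaveSourceEnergyDensityTT' tp U μ h₀ + c₁ * ((n + 1 : ℕ) : ℝ) -
          g * (((n + 1 : ℕ) : ℝ)) ^ 2 * ((((((n + 1 : ℕ) : ℂ)) ^ 4)⁻¹ *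
            ∑ x ∈ halfOpenBox 2 (n + 1), ∑ y ∈ halfOpenBox 2 (n + 1), ω.dWavePairCorr x y).re) +
          g * c₂ * ((n + 1 : ℕ) : ℝ) :=
    eventually_atTop.2 ⟨L₁, fun n hn => hL₁ (n + 1) (by omega) g hg.le⟩
  -- `m_L(h₀ + 2g‖P‖)² ≤ (∂⁺E(h₀ + 2g‖P‖)/2)² + ε/4` eventually
  have hdens := eventually_sq_dWaveSourceDensityTT'_le tp U μ hx0 (δ := ε / 4) (by positivity)
  -- `E_L(h₀)/L² → E(h₀)`
  have hconv : ∀ᶠ n : ℕ in atTop, dWaveSourceEnergyDensityTT' tp U μ h₀ -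
      (dWaveSourceTorusTT' (n + 1) tp U μ h₀).groundEnergy / (((n + 1 : ℕ) : ℝ)) ^ 2 ≤ g * ε / 8 := by
    have ht := tendsto_dWaveSourceEnergyDensityTT' tp U μ h₀
    have hev := ht.eventually (Ioi_mem_nhds
      (show dWaveSourceEnergyDensityTT' tp U μ h₀ - g * ε / 8 < dWaveSourceEnergyDensityTT' tp U μ h₀ by
        have : 0 < g * ε / 8 := by positivity
        linarith))
    filter_upwards [hev] with n hn
    have hn' : dWaveSourceEnergyDensityTT' tp U μ h₀ - g * ε / 8 <
        (dWaveSourceTorusTT' (n + 1) tp U μ h₀).groundEnergy / (((n + 1 : ℕ) : ℝ)) ^ 2 := hn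
    linarith
  -- `(c₁ + gc₂)/L → 0`
  have hsmall : ∀ᶠ n : ℕ in atTop, (c₁ + g * c₂) * ((n + 1 : ℕ) : ℝ) / (((n + 1 : ℕ) : ℝ)) ^ 2 ≤
      g * ε / 8 := by
    obtain ⟨N, hN⟩ := exists_nat_gt (|c₁ + g * c₂| / (g * ε / 8))
    refine eventually_atTop.2 ⟨N, fun n hn => ?_⟩
    have hℓ : (0 : ℝ) < ((n + 1 : ℕ) : ℝ) := by positivity
    have hgε : 0 < g * ε / 8 := by positivity
    have hNℓ : (N : ℝ) < ((n + 1 : ℕ) : ℝ) := by exact_mod_cast Nat.lt_succ_of_le hn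
    have h1 : |c₁ + g * c₂| < g * ε / 8 * ((n + 1 : ℕ) : ℝ) := by
      rw [div_lt_iff₀ hgε] at hN
      nlinarith
    rw [pow_two, mul_div_mul_right _ _ hℓ.ne', div_le_iff₀ hℓ]
    exact ((le_abs_self _).trans h1.le)
  -- assemble along `N = n + 1`
  obtain ⟨N, hN⟩ := eventually_atTop.1 (hlow.and (hup.and (hdens.and (hconv.and hsmall))))
  refine eventually_atTop.2 ⟨N + 1, fun M hM => ?_⟩
  obtain ⟨n, rfl⟩ : ∃ n, M = n + 1 := ⟨M - 1, by omega⟩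
  obtain ⟨hl, hu', hd, hc, hs⟩ := hN n (by omega)
  have hV : (0 : ℝ) < (((n + 1 : ℕ) : ℝ)) ^ 2 := by positivity
  exact boxLRO_le_of_bounds hV hg hε hl hu' hc hd ha hs

end Summit.Ventures.CertifiedManyBodySolver.Observables.SourcedTorusAHM

end
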